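import Literature.NumberTheory.Automorphic.PrincipalPowerTowerIntegralEigenclass
import Literature.NumberTheory.Automorphic.IntegralEigenclassHeckePointDescent
import Literature.NumberTheory.Automorphic.PadicUnitBallTower
import HarnessLib

/-!
# An `𝒪_{E₀}`-integral eigenclass of bounded content is a `ℤ̄_p`-point of the big Hecke algebra of
# the `p`-power principal congruence tower

Topic `NumberTheory/Automorphic`; namespace `Literature.NumberTheory.Automorphic.ResGLnCohomology`.
Theorems only; no definition, no named fact, no instance, no `sorry`.

`PrincipalPowerTowerIntegralEigenclass` treats an eigenclass integral over `ℤ̄_p`; but the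
finiteness producing such eigenclasses (bounded denominators, exact eigenvectors, bounded content)
is only available over the Noetherian rings `𝒪_{E₀}`, `E₀/ℚ_p` finite [Scholze2015, §V.4: "As
`𝕋_{K_p K^p}` is of finite type over `ℤ_p`, `x ⊗ ℚ̄_p` is defined over a finite extension `L` of
`ℚ_p`; `p^t ξ ∈ H^q(X_U, M̃_{E'})` for a `p`-integral structure over a finite `E'`"].  Here the
input is an eigenclass `c ∈ H^q(X_{U₀}, M̃)` for an `𝒪_{E₀}`-lattice `M ≅ 𝒪_{E₀}^d` in the
`p`-adic coefficient representation restricted to `𝒪_{E₀} = unitBall p E₀`, with eigenvalues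
`b_{v,i} ∈ 𝒪_{E₀}` and bounded content, and the output is the `ℤ̄_p`-point
`IsHeckePoint … ((p : ℤ̄_p)) (t_{v,i}) (b_{v,i})` of the named fact
`bianchi_regularAlgebraicCuspidal_isHeckePoint` (`TwistedQuotient.isHeckePoint_of_intFun_eigenclass_descent`
with `O = ℤ̄_p`, the intermediate rings `𝒪_{E₀(a)}` of `PadicUnitBallTower`, and the level data of
`PrincipalPowerTowerLevels`).

## References

* P. Scholze, *On torsion in the cohomology of locally symmetric varieties*, Ann. of Math. 182
  (2015), §V.4, Thm. V.4.1 and Cor. V.4.2. [Scholze2015]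
-/

noncomputable section

open CategoryTheory
open scoped NumberField
open IsDedekindDomain

namespace Literature.NumberTheory.Automorphic

namespace ResGLnCohomology

open TwistedQuotient BigHeckeGLn PadicIntermediateField

variable {n : ℕ} {K : Type} [Field K] [NumberField K] (p : ℕ) [Fact p.Prime]
  (E₀ : IntermediateField ℚ_[p] (PadicAlgCl p))
  (lam : (K →+* PadicAlgCl p) → Fin n → ℤ)

/-! ### The scalars `𝒪_{E₀}` -/

/-- The restriction of scalars of `ρ_p` to `𝒪_{E₀}` is trivial on `t_{v,i}` for `v ∤ p`.
[folklore] -/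
theorem resScalars_unitBall_padicCoeffRep_sndHom_heckeDiagAt {v : HeightOneSpectrum (𝓞 K)}
    (hv : ((p : ℕ) : 𝓞 K) ∉ v.asIdeal) (ϖ : (v.adicCompletion K)ˣ) (i : ℕ) :
    resScalars (unitBall p E₀) (padicCoeffRep n K p lam)
      (GLn.sndHom n K (heckeDiagAt n K v ϖ i)) = 1 := by
  refine LinearMap.ext fun x => ?_
  rw [resScalars_apply, padicCoeffRep_sndHom_heckeDiagAt p lam hv ϖ i]
  rfl

omit [NumberField K] in
/-- **The descent package for `𝒪_{E₀} ⊂ ℤ̄_p`**: every `a ∈ ℤ̄_p` lies in `𝒪_{E₁}` for a finite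
`E₁ ⊇ E₀`, `𝒪_{E₁}` is free over `𝒪_{E₀}`, and `𝒪_{E₁}/p^s ↪ ℤ̄_p/p^s` splits. [folklore] -/
theorem unitBall_descentPackage [FiniteDimensional ℚ_[p] E₀]
    (a : (PadicAlgCl.valued p).v.valuationSubring) :
    ∃ (k₁ : Type) (_ : CommRing k₁) (_ : Algebra (unitBall p E₀) k₁)
      (_ : Algebra k₁ (PadicAlgCl.valued p).v.valuationSubring)
      (_ : IsScalarTower (unitBall p E₀) k₁ (PadicAlgCl.valued p).v.valuationSubring)
      (Mb : Type) (_ : Module.Basis Mb (unitBall p E₀) k₁) (a₁ : k₁),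
      algebraMap k₁ (PadicAlgCl.valued p).v.valuationSubring a₁ = a ∧
      ∀ s : ℕ, ∃ r₀ : ((PadicAlgCl.valued p).v.valuationSubring ⧸
            idealBig (O := (PadicAlgCl.valued p).v.valuationSubring)
              (((p : ℕ) : unitBall p E₀) ^ s)) →ₗ[k₁]
          (k₁ ⧸ idealOne (k₁ := k₁) (((p : ℕ) : unitBall p E₀) ^ s)),
        ∀ y : k₁, r₀ (Ideal.Quotient.mk _ (algebraMap k₁ _ y)) = Ideal.Quotient.mk _ y := by
  obtain ⟨E₁, hfin, hle, ha⟩ := exists_finite_ge_mem p E₀ a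
  haveI := hfin
  letI : Algebra (unitBall p E₀) (unitBall p E₁) :=
    (Subring.inclusion (unitBall_mono p E₁ E₀ hle)).toAlgebra
  haveI : IsScalarTower (unitBall p E₀) (unitBall p E₁) (PadicAlgCl.valued p).v.valuationSubring :=
    isScalarTower_unitBall_valuationSubring p E₁ E₀ hle
  haveI : Module.Free (unitBall p E₀) (unitBall p E₁) := moduleFree_unitBall_of_le p E₁ E₀ hle
  refine ⟨unitBall p E₁, inferInstance, inferInstance, inferInstance, inferInstance,
    Module.Free.ChooseBasisIndex (unitBall p E₀) (unitBall p E₁),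
    Module.Free.chooseBasis (unitBall p E₀) (unitBall p E₁), ⟨a, ha⟩, Subtype.ext rfl, fun s => ?_⟩
  obtain ⟨r, hr⟩ := exists_retraction_mod_pow p E₁ s
  have h1 : idealBig (O := (PadicAlgCl.valued p).v.valuationSubring) (((p : ℕ) : unitBall p E₀) ^ s) =
      Ideal.span ({algebraMap (unitBall p E₁) (PadicAlgCl.valued p).v.valuationSubring
        (((p : ℕ) : unitBall p E₁) ^ s)} : Set _) := by
    rw [idealBig, map_pow, map_natCast, map_pow, map_natCast]
  have h2 : Ideal.span ({((p : ℕ) : unitBall p E₁) ^ s} : Set _) =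
      idealOne (k₁ := unitBall p E₁) (((p : ℕ) : unitBall p E₀) ^ s) := by
    rw [idealOne, map_pow, map_natCast]
  refine ⟨(Ideal.quotientEquivAlgOfEq (unitBall p E₁) h2).toLinearMap ∘ₗ r ∘ₗ
    (Ideal.quotientEquivAlgOfEq (unitBall p E₁) h1).toLinearMap, fun y => ?_⟩
  simp only [LinearMap.comp_apply, AlgEquiv.toLinearMap_apply]
  rw [Ideal.quotientEquivAlgOfEq_mk, hr, Ideal.quotientEquivAlgOfEq_mk]

/-! ### The instantiation -/

/-- **An `𝒪_{E₀}`-integral eigenclass of bounded content is a `ℤ̄_p`-point of the big Hecke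
algebra of the `p`-power principal congruence tower.**  As
`isHeckePoint_principalPowerTower_of_intFun_eigenclass`, but with the lattice `M ≅ 𝒪_{E₀}^d`, the
eigenclass `c`, its eigenvalues `b_{v,i}` and its content bound over the finite extension
`𝒪_{E₀} = unitBall p E₀` of `ℤ_p`; the conclusion is the `ℤ̄_p`-point with values
`b_{v,i} ∈ 𝒪_{E₀} ⊂ ℤ̄_p`. [cite: Scholze2015, §V.4, Thm. V.4.1 and Cor. V.4.2 (proofs)] -/
theorem isHeckePoint_principalPowerTower_of_intFun_eigenclass_unitBall
    [FiniteDimensional ℚ_[p] E₀]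
    (good : HeightOneSpectrum (𝓞 K) → Prop)
    (hgood : ∀ v, good v → ((p : ℕ) : 𝓞 K) ∉ v.asIdeal)
    {U₀ : Subgroup (FiniteAdelicGL n K)} (hU₀o : IsOpen (U₀ : Set (FiniteAdelicGL n K)))
    (hU₀c : IsCompact (U₀ : Set (FiniteAdelicGL n K))) (hU₀ : U₀ ≤ glFiniteIntegralLevel n K)
    (hU₁ : ∀ v, good v → ∀ g ∈ valuedCongruenceSubgroup (Fin n) (1 : WithZero (Multiplicative ℤ)),
      ofLocal n K v g ∈ U₀)
    (M : Submodule (unitBall p E₀) (CoeffModule (PadicAlgCl p) n K lam))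
    (hM : ∀ u ∈ U₀, ∀ m ∈ M, resScalars (unitBall p E₀) (padicCoeffRep n K p lam) u m ∈ M)
    {d : ℕ} (e : M ≃ₗ[unitBall p E₀] (Fin d → unitBall p E₀))
    (hmod : ∀ t' : ℕ, ∃ r : ℕ,
      ModTrivialOn (resScalars (unitBall p E₀) (padicCoeffRep n K p lam)) M hM (p ^ t')
        (U₀ ⊓ (principalCongruenceLevel n K (Ideal.span {((p : ℕ) : 𝓞 K)} ^ r)).comap
          (GLn.ofFinite n K)))
    (ϖ : ∀ v : HeightOneSpectrum (𝓞 K), (v.adicCompletion K)ˣ)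
    (b : {v // good v} → ℕ → unitBall p E₀) {q : ℕ}
    (c : groupCohomology (intFun (globalEmbedding n K) U₀
      (resScalars (unitBall p E₀) (padicCoeffRep n K p lam)) M) q)
    (heig : ∀ j : {v // good v} × Fin n,
      (groupCohomology.map (MonoidHom.id (GL (Fin n) K))
        (A := intFun (globalEmbedding n K) U₀ (resScalars (unitBall p E₀) (padicCoeffRep n K p lam)) M)
        (B := intFun (globalEmbedding n K) U₀ (resScalars (unitBall p E₀) (padicCoeffRep n K p lam)) M)
        (heckeIntHom (globalEmbedding n K) U₀
          (resScalars (unitBall p E₀) (padicCoeffRep n K p lam)) M hM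
          (rep_mem_of_eq_one _ M
            (resScalars_unitBall_padicCoeffRep_sndHom_heckeDiagAt p E₀ lam (hgood _ j.1.2) (ϖ j.1.1)
              (j.2.val + 1)))) q).hom c = b j.1 (j.2.val + 1) • c)
    {m₀ : ℕ} (hcont : ∀ (u : ℕ) (y : groupCohomology (intFun (globalEmbedding n K) U₀
      (resScalars (unitBall p E₀) (padicCoeffRep n K p lam)) M) q),
      ((p : ℕ) : unitBall p E₀) ^ u • c ≠ ((p : ℕ) : unitBall p E₀) ^ (u + m₀) • y) :
    IsHeckePoint (globalEmbedding n K)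
      (LevelTower.ofSeq U₀ fun r : ℕ =>
        (principalCongruenceLevel n K (Ideal.span {((p : ℕ) : 𝓞 K)} ^ r)).map (GLn.sndHom n K))
      ((p : ℕ) : (PadicAlgCl.valued p).v.valuationSubring)
      (fun j : {v // good v} × Fin n =>
        GLn.sndHom n K (heckeDiagAt n K j.1.1 (ϖ j.1.1) (j.2.val + 1)))
      (fun j => algebraMap (unitBall p E₀) (PadicAlgCl.valued p).v.valuationSubring
        (b j.1 (j.2.val + 1))) := by
  -- notation
  set T : LevelTower (FiniteAdelicGL n K) := LevelTower.ofSeq U₀ fun r : ℕ =>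
    (principalCongruenceLevel n K (Ideal.span {((p : ℕ) : 𝓞 K)} ^ r)).map (GLn.sndHom n K) with hT
  have h𝔭 := span_natCast_prime_ne_zero (K := K) p
  have hlevel : ∀ r : ℕ, T.level r = U₀ ⊓ (principalCongruenceLevel n K
      (Ideal.span {((p : ℕ) : 𝓞 K)} ^ r)).comap (GLn.ofFinite n K) := fun r =>
    ofSeq_comap_principalCongruenceLevel_pow_level h𝔭 U₀ r
  have hδ : ∀ j : {v // good v} × Fin n,
      GLn.sndHom n K (heckeDiagAt n K j.1.1 (ϖ j.1.1) (j.2.val + 1)) =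
        ofLocal n K j.1.1 (glDiagonal n (j.1.1.adicCompletion K)
          fun k => if (k : ℕ) < j.2.val + 1 then ϖ j.1.1 else 1) := fun j =>
    sndHom_heckeDiagAt_eq_ofLocal _ _ _
  have hpO : ((p : ℕ) : (PadicAlgCl.valued p).v.valuationSubring) =
      (p : (PadicAlgCl.valued p).v.valuationSubring) := rfl
  refine isHeckePoint_of_intFun_eigenclass_descent (globalEmbedding n K) T p
    (resScalars (unitBall p E₀) (padicCoeffRep n K p lam)) U₀ M hM
    (fun j : {v // good v} × Fin n => GLn.sndHom n K (heckeDiagAt n K j.1.1 (ϖ j.1.1) (j.2.val + 1)))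
    (fun j => b j.1 (j.2.val + 1)) (dvd_total p E₀) (fun a b => ValuationRing.dvd_total a b)
    (isLeftRegular_natCast_prime_valuationSubring p)
    -- no `p`-torsion over `𝒪_{E₀}`: `smul_natCast_prime_eq_zero` (scalars `ℤ̄_p`) applies verbatim, the
    -- two subring actions on `V` agreeing definitionally through `ℚ̄_p` (both are `(p : ℚ̄_p) • v`)
    (fun v hv => smul_natCast_prime_eq_zero p v hv) e
    (fun j => resScalars_unitBall_padicCoeffRep_sndHom_heckeDiagAt p E₀ lam (hgood _ j.1.2) (ϖ j.1.1) _)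
    (fun j => finite_doubleCosetQuot hU₀o hU₀c _) (fun t' => ?_) c heig hcont
    (unitBall_descentPackage p E₀)
  -- the level data at `t'` (verbatim as in `PrincipalPowerTowerIntegralEigenclass`)
  obtain ⟨r, hr⟩ := hmod t'
  have hle : T.level r ≤ U₀ := by rw [hlevel]; exact inf_le_left
  refine ⟨r, hle, ?_, ?_, fun j u => ?_, fun j => ?_, fun j => ?_⟩
  · rw [hlevel]; exact normal_inf_comap_principalCongruenceLevel_subgroupOf hU₀ _
  · intro l hl m
    exact hr l (by rw [← hlevel]; exact hl) m
  · obtain ⟨-, hconj, -, -⟩ := levelData_inf_comap_principalCongruenceLevel hU₀o hU₀c hU₀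
      (hU₁ _ j.1.2) (pow_ne_zero r h𝔭) (not_dvd_pow_of_not_le (not_span_le_of_not_mem p
        (hgood _ j.1.2)) r)
      (glDiagonal n (j.1.1.adicCompletion K) fun k => if (k : ℕ) < j.2.val + 1 then ϖ j.1.1 else 1)
    obtain ⟨x, hx, y, hy, hxy⟩ := hconj u
    refine ⟨x, by rw [hlevel]; exact hx, y, by rw [hlevel]; exact hy, ?_⟩
    rw [hδ]
    exact hxy
  · obtain ⟨-, -, hbij, -⟩ := levelData_inf_comap_principalCongruenceLevel hU₀o hU₀c hU₀
      (hU₁ _ j.1.2) (pow_ne_zero r h𝔭) (not_dvd_pow_of_not_le (not_span_le_of_not_mem p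
        (hgood _ j.1.2)) r)
      (glDiagonal n (j.1.1.adicCompletion K) fun k => if (k : ℕ) < j.2.val + 1 then ϖ j.1.1 else 1)
    rw [hδ]
    convert hbij using 2 <;> first | rfl | exact hlevel r
  · obtain ⟨-, -, -, hfin⟩ := levelData_inf_comap_principalCongruenceLevel hU₀o hU₀c hU₀
      (hU₁ _ j.1.2) (pow_ne_zero r h𝔭) (not_dvd_pow_of_not_le (not_span_le_of_not_mem p
        (hgood _ j.1.2)) r)
      (glDiagonal n (j.1.1.adicCompletion K) fun k => if (k : ℕ) < j.2.val + 1 then ϖ j.1.1 else 1)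
    rw [hδ, hlevel]
    exact hfin

end ResGLnCohomology

end Literature.NumberTheory.Automorphic
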